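import Literature.NumberTheory.GaloisRepresentations.UnramifiedRadicalDescent
import Literature.NumberTheory.GaloisRepresentations.ArtinReciprocityCharacterFiniteProofs
import Literature.NumberTheory.GaloisRepresentations.GaloisSubgroups
import Literature.NumberTheory.GaloisRepresentations.RestrictedRamification
import Literature.NumberTheory.GaloisRepresentations.GaloisRep
import HarnessLib

/-!
# Radical classes of `K_S` invariant under `Γ_K` come from `K`, up to the class number

Topic `NumberTheory/GaloisRepresentations`; namespace `Literature.NumberTheory.GaloisRepresentations`.
Everything here is **proved** (no named fact, no public definition, no instance; D-0026).  Sequel of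
`UnramifiedRadicalDescent.lean`, transporting its finite-level descent to the absolute Galois group
`Γ_K = Field.absoluteGaloisGroup K` and the tree's ramification subgroup
`N_S = ramificationSubgroup K S` (`RestrictedRamification.lean`; `K_S = K̄^{N_S}`,
`G_S = Γ_K ⧸ N_S`), for a number field `K`, a prime `p` and a set `S` of finite places containing
all `v ∣ p`:

* `ramificationSubgroup_le_of_inertia_le` — `N_S` lies in every CLOSED subgroup containing the
  inertia groups outside `S` (conjugates of inertia elements are inertia elements);
* `smul_eq_self_of_mem_ramificationSubgroup_of_pow_eq_one` — `N_S` fixes `μ_{p^∞}` (`S ⊇ {v ∣ p}`);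
* `exists_isGalois_subset_ramificationSubgroup_le_galFixing` — a finite subset of `K_S` lies in a
  finite Galois `L ⊆ K_S`; `isUnramifiedIn_of_ramificationSubgroup_le_galFixing` — such an `L` is
  unramified (Mathlib `Algebra.IsUnramifiedIn`) at every finite place outside `S`;
* **`exists_pow_eq_mul_pow_of_smul_invariant`** — if `b ∈ K_Sˣ` has `σ b ∈ b · (K_Sˣ)^{p^m}` for all
  `σ ∈ Γ_K`, then `b^{p^e h'} = c · α^{p^{m+e}}` with `c ∈ Kˣ`, `α ∈ K_S`, where `#Cl(𝓞_K) = p^e h'`,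
  `p ∤ h'`.

The last statement is the arithmetic behind: *the kernel of the inflation
`H²(G_S(K), μ_{p^m}) → H²(K, μ_{p^m})` — by the five-term sequence the transgression image of
`H¹(N_S, μ_{p^m})^{G_S} = (K_Sˣ/(K_Sˣ)^{p^m})^{G_S}` modulo `Kˣ` — dies under
`μ_{p^m} ↪ μ_{p^{m+e}}`* (Neukirch–Schmidt–Wingberg VIII §3, proof of (8.3.11): the term
`Cl_S(K)/p^m`; there via the cohomology of `S`-units and `S`-idèle classes, here class-field-theory
free: class-number finiteness, `e = 1` off `S`, and the Kummer criterion), a step on the tree's road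
to Iwasawa's theorem `H²(G_S(K^{cyc}_∞), ℚ_p/ℤ_p) = 0` (NSW (10.3.25), named fact
`IwasawaTheory.weakLeopoldt_H2_subsingleton_cyclotomic_of_isOpen`).  NOT here: Kummer theory over
`K_S` (`Hom_cont(N_S, μ_{p^m})` = radicals) and the cocycle bookkeeping — later files.

## References

* J. Neukirch, A. Schmidt, K. Wingberg, *Cohomology of Number Fields*, 2nd ed. (2008), VIII §3
  (the group `G_S`; (8.3.11) and its proof); X §3 (10.3.25). [NeukirchSchmidtWingberg2008]
* J.-P. Serre, *Abelian ℓ-adic representations and elliptic curves* (1968), I §1.2 (the cyclotomic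
  character is unramified away from `ℓ`). [SerreAbelianLadic1968]

## Mathlib / tree search

Tree: `inertia_le_ramificationSubgroup`, `conj_mem_inertiaOutside`, `mem_inertiaOutside_iff`
(`RestrictedRamification`); `galFixing`, `mem_galFixing_iff`, `smul_eq_self_of_mem_adjoin`,
`isOpen_galFixing`, `isClosed_galFixing` (`LocalWeilDatum`); `exists_finiteDimensional_isGalois_galFixing_subset`,
`resGal`, `coe_resGal_apply`, `resGal_surjective`, `ker_resGal`, `galFixing_lift_fixedField`
(`GaloisSubgroups`); `exists_mem_inertia_absRestrictNormalHom_ne_one`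
(`ArtinReciprocityCharacterFiniteProofs`); `smul_eq_self_of_mem_inertia_of_pow_prime_pow_eq_one`
(`GaloisRep`); `smul_root_eq_of_mem_inertia_of_dvd`, `exists_dvd_log_valuation_pow_mul_of_galois_invariant`
(`UnramifiedRadicalDescent`).  Mathlib: `InfiniteGalois.fixedField_fixingSubgroup`,
`IntermediateField.le_iff_le`, `IsGalois.of_fixedField_normal_subgroup`, `IntermediateField.liftAlgEquiv`,
`Nat.ordProj_mul_ordCompl_eq_self`, `Nat.not_dvd_ordCompl`, `HasEnoughRootsOfUnity.exists_primitiveRoot`,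
`IsAlgClosed.exists_pow_nat_eq`.  `lean search 'ramificationSubgroup_le_of|smul_invariant.*pow|radical.*K_S'`:
no prior statement.
-/

noncomputable section

open scoped NumberField nonZeroDivisors IntermediateField
open NumberField IsDedekindDomain IsDedekindDomain.HeightOneSpectrum Field WithZero IntermediateField
open Literature.NumberTheory.GaloisRepresentations.LocalWeilDatum

universe u

namespace Literature.NumberTheory.GaloisRepresentations

variable (K : Type u) [Field K]

/-! ### §1. `N_S` is contained in every closed subgroup containing the inertia groups outside `S` -/

/-- **Minimality of `N_S` among closed subgroups**: a closed subgroup `H ≤ Γ_K` containing every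
inertia group `I_𝔓`, `𝔓 ∣ v ∉ S`, contains `N_S = ramificationSubgroup K S` (the conjugates of
inertia elements outside `S` are inertia elements outside `S`, so the normal closure of
`inertiaOutside K S` is its subgroup closure). [cite: NeukirchSchmidtWingberg2008, VIII §3] -/
theorem ramificationSubgroup_le_of_inertia_le {S : Set (HeightOneSpectrum (𝓞 K))}
    {H : Subgroup (absoluteGaloisGroup K)} (hH : IsClosed (H : Set (absoluteGaloisGroup K)))
    (h : ∀ v ∉ S, ∀ 𝔓 ∈ v.primesAbove, 𝔓.inertia (absoluteGaloisGroup K) ≤ H) :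
    ramificationSubgroup K S ≤ H := by
  refine Subgroup.topologicalClosure_minimal _ ?_ hH
  unfold Subgroup.normalClosure
  rw [Subgroup.closure_le]
  intro x hx
  obtain ⟨a, ha, hconj⟩ := Group.mem_conjugatesOfSet_iff.mp hx
  obtain ⟨c, rfl⟩ := isConj_iff.mp hconj
  obtain ⟨v, hv, 𝔓, h𝔓, hmem⟩ := mem_inertiaOutside_iff.mp (conj_mem_inertiaOutside ha c)
  exact h v hv 𝔓 h𝔓 hmem

/-- An element of `K̄` fixed by every inertia group outside `S` is fixed by `N_S`. [folklore] -/
private theorem smul_eq_self_of_mem_ramificationSubgroup {S : Set (HeightOneSpectrum (𝓞 K))}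
    {x : AlgebraicClosure K}
    (hx : ∀ v ∉ S, ∀ 𝔓 ∈ v.primesAbove, ∀ σ ∈ 𝔓.inertia (absoluteGaloisGroup K), σ • x = x)
    {g : absoluteGaloisGroup K} (hg : g ∈ ramificationSubgroup K S) : g • x = x := by
  have hle : ramificationSubgroup K S ≤ galFixing K K⟮x⟯ :=
    ramificationSubgroup_le_of_inertia_le K (isClosed_galFixing K K⟮x⟯) fun v hv 𝔓 h𝔓 σ hσ =>
      (mem_galFixing_iff K).mpr fun y hy =>
        smul_eq_self_of_mem_adjoin K (S := {x}) (fun z hz => by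
          rw [Set.mem_singleton_iff.mp hz]; exact hx v hv 𝔓 h𝔓 σ hσ) hy
  exact (mem_galFixing_iff K).mp (hle hg) x (mem_adjoin_simple_self K x)

variable [NumberField K]

/-- **`N_S` fixes the `p`-power roots of unity when `S ⊇ {v ∣ p}`** (`K(μ_{p^∞}) ⊆ K_S`): inertia
at `v ∤ p` fixes every `t` with `t^{p^n} = 1` (tree
`smul_eq_self_of_mem_inertia_of_pow_prime_pow_eq_one`, Serre, *Abelian ℓ-adic representations*
I §1.2). [cite: NeukirchSchmidtWingberg2008, VIII §3] -/
theorem smul_eq_self_of_mem_ramificationSubgroup_of_pow_eq_one {p : ℕ} [Fact p.Prime]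
    {S : Set (HeightOneSpectrum (𝓞 K))}
    (hS : ∀ v : HeightOneSpectrum (𝓞 K), ((p : ℕ) : 𝓞 K) ∈ v.asIdeal → v ∈ S)
    {t : AlgebraicClosure K} {n : ℕ} (ht : t ^ p ^ n = 1)
    {g : absoluteGaloisGroup K} (hg : g ∈ ramificationSubgroup K S) : g • t = t :=
  smul_eq_self_of_mem_ramificationSubgroup K
    (fun v hv _ h𝔓 _ hσ => smul_eq_self_of_mem_inertia_of_pow_prime_pow_eq_one (ℓ := p)
      (fun hpv => hv (hS v hpv)) h𝔓 hσ ht) hg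

/-! ### §2. A finite Galois hull inside `K_S` -/

/-- **Finite Galois hulls inside `K_S`.**  A finite subset `T ⊆ K̄` fixed pointwise by `N_S` lies in
a finite Galois extension `L ⊆ K̄` of `K` which is itself fixed pointwise by `N_S` (i.e. `L ⊆ K_S`):
take a finite Galois `E ⊇ K(T)` (Krull topology, tree
`exists_finiteDimensional_isGalois_galFixing_subset`) and `L = E^{H}` for the image `H` of `N_S` in
`Gal(E/K)`. [cite: NeukirchSchmidtWingberg2008, VIII §3] -/
theorem exists_isGalois_subset_ramificationSubgroup_le_galFixing
    {S : Set (HeightOneSpectrum (𝓞 K))} {T : Set (AlgebraicClosure K)} (hT : T.Finite)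
    (hfix : ∀ t ∈ T, ∀ g ∈ ramificationSubgroup K S, g • t = t) :
    ∃ L : IntermediateField K (AlgebraicClosure K), FiniteDimensional K L ∧ IsGalois K L ∧
      T ⊆ L ∧ ramificationSubgroup K S ≤ galFixing K L := by
  classical
  haveI : Finite T := hT.to_subtype
  set M : IntermediateField K (AlgebraicClosure K) := IntermediateField.adjoin K T with hMdef
  haveI : FiniteDimensional K M :=
    IntermediateField.finiteDimensional_adjoin fun x _ => Algebra.IsIntegral.isIntegral x
  obtain ⟨E, hEfin, hEgal, hEU⟩ := exists_finiteDimensional_isGalois_galFixing_subset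
    ((isOpen_galFixing K M).mem_nhds (galFixing K M).one_mem)
  haveI := hEfin
  haveI := hEgal
  -- `M ≤ E`
  have hME : M ≤ E := by
    have h1 : E.fixingSubgroup ≤ M.fixingSubgroup := by
      intro φ hφ
      have h2 : (absoluteGaloisGroup.toAlgEquiv K).symm φ ∈ galFixing K E := by
        change (absoluteGaloisGroup.toAlgEquiv K) ((absoluteGaloisGroup.toAlgEquiv K).symm φ) ∈
          E.fixingSubgroup
        rwa [MulEquiv.apply_symm_apply]
      have h3 := hEU h2
      change (absoluteGaloisGroup.toAlgEquiv K) ((absoluteGaloisGroup.toAlgEquiv K).symm φ) ∈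
        M.fixingSubgroup at h3
      rwa [MulEquiv.apply_symm_apply] at h3
    rw [← InfiniteGalois.fixedField_fixingSubgroup E]
    exact (IntermediateField.le_iff_le _ _).mpr h1
  -- the image `H` of `N_S` in `Gal(E/K)` and `L = E^H`
  set H : Subgroup (E ≃ₐ[K] E) := (ramificationSubgroup K S).map (resGal E) with hHdef
  haveI : H.Normal := Subgroup.Normal.map inferInstance _ (resGal_surjective E)
  haveI : IsGalois K (fixedField H) := IsGalois.of_fixedField_normal_subgroup H
  refine ⟨lift (fixedField H), (liftAlgEquiv _).toLinearEquiv.finiteDimensional,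
    IsGalois.of_algEquiv (liftAlgEquiv _), fun t ht => ?_, ?_⟩
  · have htE : t ∈ E := hME (hMdef ▸ IntermediateField.subset_adjoin K T ht)
    have hy : (⟨t, htE⟩ : E) ∈ fixedField H := by
      rw [IntermediateField.mem_fixedField_iff]
      rintro φ ⟨g, hg, rfl⟩
      apply Subtype.ext
      change ((resGal E g ⟨t, htE⟩ : E) : AlgebraicClosure K) = t
      rw [coe_resGal_apply]
      exact hfix t ht g hg
    exact (mem_lift ⟨t, htE⟩).2 hy
  · rw [galFixing_lift_fixedField]
    exact Subgroup.le_comap_map _ _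

/-! ### §3. The descent over `Γ_K` -/

/-- For a finite Galois `L ⊆ K̄` fixed pointwise by `N_S`, **`L/K` is unramified at every finite
place outside `S`** (Mathlib `Algebra.IsUnramifiedIn`): otherwise an inertia element of `Γ_K` above
such a place acts non-trivially on `L` (tree `exists_mem_inertia_absRestrictNormalHom_ne_one`), yet
it lies in `N_S`. [cite: NeukirchSchmidtWingberg2008, VIII §3] -/
theorem isUnramifiedIn_of_ramificationSubgroup_le_galFixing {S : Set (HeightOneSpectrum (𝓞 K))}
    (L : IntermediateField K (AlgebraicClosure K)) [FiniteDimensional K L] [IsGalois K L]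
    (hL : ramificationSubgroup K S ≤ galFixing K L) {v : HeightOneSpectrum (𝓞 K)} (hv : v ∉ S) :
    Algebra.IsUnramifiedIn (𝓞 L) v.asIdeal := by
  haveI : NumberField L := NumberField.of_module_finite K L
  by_contra hram
  obtain ⟨𝔓, h𝔓, g, hg, hne⟩ := exists_mem_inertia_absRestrictNormalHom_ne_one L hram
  apply hne
  have hg' : g ∈ (resGal L).ker := by
    rw [ker_resGal]
    exact hL (inertia_le_ramificationSubgroup hv h𝔓 hg)
  exact (MonoidHom.mem_ker).mp hg'


/-- **Radical classes of `K_S` invariant under `Γ_K` come from `K` up to the class number.**  Let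
`K` be a number field, `p` a prime, `S` a set of finite places containing every `v ∣ p`, and
`N_S ≤ Γ_K` the ramification subgroup outside `S` (`K_S = K̄^{N_S}`).  Let `b ∈ K_Sˣ` be such that
for every `σ ∈ Γ_K`, `σ b = b · γ_σ^{p^m}` with `γ_σ ∈ K_S` (the class of `b` in
`K_Sˣ/(K_Sˣ)^{p^m}` is `G_S`-invariant).  Then, writing `#Cl(𝓞_K) = p^e h'` with `p ∤ h'`,
`b^{p^e h'} = c · α^{p^{m+e}}` for some `c ∈ Kˣ` and `α ∈ K_S`.  (With Kummer theory over `K_S ⊇ μ_{p^∞}`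
this says: the transgression image `(K_Sˣ/p^m)^{G_S}/Kˣ ⊆ H²(G_S, μ_{p^m})` — the kernel of
`H²(G_S, μ_{p^m}) → H²(K, μ_{p^m})` — is killed by `μ_{p^m} ↪ μ_{p^{m+e}}`; Neukirch–Schmidt–Wingberg
(8.3.11), proof, the `Cl_S`-term, here without class field theory.)  Proof: finite Galois hull
`L ⊆ K_S` of `b`, the `γ`'s and `ζ_{p^{m+e}}` (§2); `L/K` is unramified outside `S`;
`exists_dvd_log_valuation_pow_mul_of_galois_invariant` gives `c` with
`p^{m+e} ∣ ord_w(b^h c)` off `S`; a `p^{m+e}`-th root `α` of `b^h c` is fixed by every inertia group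
outside `S` (`smul_root_eq_of_mem_inertia_of_dvd`), hence by `N_S`.
[cite: NeukirchSchmidtWingberg2008, VIII §3 (8.3.11) (proof)] -/
theorem exists_pow_eq_mul_pow_of_smul_invariant {p : ℕ} [Fact p.Prime]
    {S : Set (HeightOneSpectrum (𝓞 K))}
    (hS : ∀ v : HeightOneSpectrum (𝓞 K), ((p : ℕ) : 𝓞 K) ∈ v.asIdeal → v ∈ S)
    (m : ℕ) {b : AlgebraicClosure K} (hb : b ≠ 0)
    (hbN : ∀ g ∈ ramificationSubgroup K S, g • b = b)
    (hinv : ∀ σ : absoluteGaloisGroup K, ∃ γ : AlgebraicClosure K,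
      (∀ g ∈ ramificationSubgroup K S, g • γ = γ) ∧ σ • b = b * γ ^ p ^ m) :
    ∃ e h' : ℕ, ¬ p ∣ h' ∧ ∃ c : K, c ≠ 0 ∧ ∃ α : AlgebraicClosure K,
      (∀ g ∈ ramificationSubgroup K S, g • α = α) ∧
      b ^ (p ^ e * h') = algebraMap K (AlgebraicClosure K) c * α ^ p ^ (m + e) := by
  classical
  have hp : p.Prime := Fact.out
  -- `#Cl(𝓞 K) = p^e h'`
  set h : ℕ := Fintype.card (ClassGroup (𝓞 K)) with hh
  have hh0 : h ≠ 0 := Fintype.card_ne_zero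
  set e : ℕ := h.factorization p with he
  set h' : ℕ := h / p ^ e with hh'
  have hdecomp : p ^ e * h' = h := Nat.ordProj_mul_ordCompl_eq_self h p
  have hndvd : ¬ p ∣ h' := Nat.not_dvd_ordCompl hp hh0
  set d : ℕ := p ^ (m + e) with hd
  have hd0 : 0 < d := pow_pos hp.pos _
  have hdh : (d : ℤ) ∣ ((h * p ^ m : ℕ) : ℤ) := by
    refine Int.natCast_dvd_natCast.mpr ⟨h', ?_⟩
    rw [← hdecomp, hd, pow_add]
    ring
  -- a primitive `d`-th root of unity, fixed by `N_S`
  haveI : NeZero ((d : ℕ) : AlgebraicClosure K) := ⟨Nat.cast_ne_zero.mpr hd0.ne'⟩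
  obtain ⟨ζ, hζ⟩ := HasEnoughRootsOfUnity.exists_primitiveRoot (AlgebraicClosure K) d
  have hζN : ∀ g ∈ ramificationSubgroup K S, g • ζ = ζ := fun g hg =>
    smul_eq_self_of_mem_ramificationSubgroup_of_pow_eq_one K hS (n := m + e) hζ.pow_eq_one hg
  -- stage 1: a finite Galois `L₀ ∋ b` inside `K_S`, lifts of `Gal(L₀/K)` and their `γ`'s
  obtain ⟨L₀, hL₀fin, hL₀gal, hbL₀, -⟩ :=
    exists_isGalois_subset_ramificationSubgroup_le_galFixing K (S := S) (Set.finite_singleton b)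
      (fun t ht g hg => by rw [Set.mem_singleton_iff.mp ht]; exact hbN g hg)
  haveI := hL₀fin
  haveI := hL₀gal
  have hbL₀' : b ∈ L₀ := hbL₀ (Set.mem_singleton b)
  choose γ hγN hγb using hinv
  choose lft hlft using resGal_surjective L₀
  have hσb : ∀ σ : absoluteGaloisGroup K, σ • b = b * γ (lft (resGal L₀ σ)) ^ p ^ m := by
    intro σ
    rw [← hγb (lft (resGal L₀ σ))]
    have h1 := coe_resGal_apply L₀ σ ⟨b, hbL₀'⟩
    have h2 := coe_resGal_apply L₀ (lft (resGal L₀ σ)) ⟨b, hbL₀'⟩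
    rw [hlft] at h2
    exact h1.symm.trans h2
  -- stage 2: the finite Galois hull `L ⊆ K_S` of `b`, `ζ` and the `γ`'s
  set T : Set (AlgebraicClosure K) :=
    {b, ζ} ∪ Set.range (fun τ : L₀ ≃ₐ[K] L₀ => γ (lft τ)) with hT
  have hTfin : T.Finite := ((Set.finite_singleton ζ).insert b).union (Set.finite_range _)
  have hTfix : ∀ t ∈ T, ∀ g ∈ ramificationSubgroup K S, g • t = t := by
    rintro t (ht | ⟨τ, rfl⟩) g hg
    · rcases ht with rfl | ht
      · exact hbN g hg
      · rw [Set.mem_singleton_iff.mp ht]; exact hζN g hg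
    · exact hγN _ g hg
  obtain ⟨L, hLfin, hLgal, hTL, hLN⟩ :=
    exists_isGalois_subset_ramificationSubgroup_le_galFixing K hTfin hTfix
  haveI := hLfin
  haveI := hLgal
  haveI : NumberField L := NumberField.of_module_finite K L
  have hbL : b ∈ L := hTL (Or.inl (Or.inl rfl))
  have hζL : ζ ∈ L := hTL (Or.inl (Or.inr rfl))
  have hγL : ∀ τ : L₀ ≃ₐ[K] L₀, γ (lft τ) ∈ L := fun τ => hTL (Or.inr ⟨τ, rfl⟩)
  set bL : L := ⟨b, hbL⟩ with hbLdef
  have hbL0 : bL ≠ 0 := fun h0 => hb (congrArg Subtype.val h0)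
  -- the invariance hypothesis at the level of `Gal(L/K)`
  have hγτ : ∀ τ : L ≃ₐ[K] L, ∃ γ' : L, τ bL = bL * γ' ^ p ^ m := by
    intro τ
    obtain ⟨σ, hσ⟩ := resGal_surjective L τ
    refine ⟨⟨γ (lft (resGal L₀ σ)), hγL _⟩, Subtype.ext ?_⟩
    rw [← hσ]
    change ((resGal L σ bL : L) : AlgebraicClosure K) = b * γ (lft (resGal L₀ σ)) ^ p ^ m
    rw [coe_resGal_apply]
    exact hσb σ
  obtain ⟨c, hc0, hc⟩ := exists_dvd_log_valuation_pow_mul_of_galois_invariant S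
    (fun v hv => isUnramifiedIn_of_ramificationSubgroup_le_galFixing K L hLN hv)
    (pow_pos hp.pos m) hbL0 hγτ
  -- `u = b^h c` and a `d`-th root `α`
  set u : L := bL ^ h * algebraMap K L c with hudef
  have hu0 : u ≠ 0 := mul_ne_zero (pow_ne_zero _ hbL0) ((map_ne_zero _).mpr hc0)
  obtain ⟨α, hα⟩ := IsAlgClosed.exists_pow_nat_eq ((u : L) : AlgebraicClosure K) hd0
  have hα' : α ^ d = algebraMap L (AlgebraicClosure K) u := hα
  set ζL : L := ⟨ζ, hζL⟩ with hζLdef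
  have hζL' : IsPrimitiveRoot ζL d :=
    IsPrimitiveRoot.of_map_of_injective (f := algebraMap L (AlgebraicClosure K))
      (by exact hζ) (algebraMap L (AlgebraicClosure K)).injective
  -- `α` is fixed by every inertia group outside `S`, hence by `N_S`
  have hαN : ∀ g ∈ ramificationSubgroup K S, g • α = α := by
    intro g hg
    refine smul_eq_self_of_mem_ramificationSubgroup K (fun v hv 𝔓 h𝔓 σ hσ => ?_) hg
    haveI : 𝔓.IsPrime := h𝔓.1
    have hσL : σ ∈ galFixing K L := hLN (inertia_le_ramificationSubgroup hv h𝔓 hσ)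
    -- `σ` as an `L`-automorphism of `K̄`
    let σL : AlgebraicClosure K ≃ₐ[L] AlgebraicClosure K :=
      { absoluteGaloisGroup.toAlgEquiv K σ with
        commutes' := fun x => (mem_galFixing_iff K).mp hσL x x.2 }
    have hσLapply : ∀ x : AlgebraicClosure K, σL x = σ • x := fun x => rfl
    -- the prime of the integral closure of `𝓞 L` in `K̄` below `𝔓`, and the place `w` of `L`
    let ι : integralClosure (𝓞 L) (AlgebraicClosure K) →+* absIntegers (𝓞 K) K :=
      (integralClosure (𝓞 L) (AlgebraicClosure K)).val.toRingHom.codRestrict (absIntegers (𝓞 K) K)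
        fun x => by
          rw [mem_integralClosure_iff]
          exact (isIntegral_trans (R := ℤ) (A := 𝓞 L) (x : AlgebraicClosure K) x.2).tower_top
    set 𝔓' : Ideal (integralClosure (𝓞 L) (AlgebraicClosure K)) := 𝔓.comap ι with h𝔓'def
    haveI h𝔓'prime : 𝔓'.IsPrime := Ideal.comap_isPrime ι 𝔓
    set W : Ideal (𝓞 L) := 𝔓'.under (𝓞 L) with hWdef
    have hWv : W.under (𝓞 K) = v.asIdeal := by
      ext x
      rw [Ideal.under, Ideal.mem_comap, hWdef, Ideal.under, Ideal.mem_comap, h𝔓'def,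
        Ideal.mem_comap, h𝔓.2.over, Ideal.under, Ideal.mem_comap]
      exact Iff.rfl
    have hW0 : W ≠ ⊥ := fun h0 => v.ne_bot (by
      rw [← hWv, h0]
      exact Ideal.comap_bot_of_injective _ (FaithfulSMul.algebraMap_injective (𝓞 K) (𝓞 L)))
    let w : HeightOneSpectrum (𝓞 L) := ⟨W, Ideal.IsPrime.under (𝓞 L) 𝔓', hW0⟩
    haveI : 𝔓'.LiesOver w.asIdeal := ⟨rfl⟩
    have hwv : w.under (𝓞 K) = v := HeightOneSpectrum.ext hWv
    have hwS : w.under (𝓞 K) ∉ S := by rw [hwv]; exact hv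
    -- `w ∤ d`
    have hpv : ((p : ℕ) : 𝓞 K) ∉ v.asIdeal := fun hpv => hv (hS v hpv)
    have hdw : ((d : ℕ) : 𝓞 L) ∉ w.asIdeal := by
      intro hdw
      apply hpv
      rw [hd, Nat.cast_pow] at hdw
      have h1 : ((p : ℕ) : 𝓞 L) ∈ w.asIdeal := w.isPrime.mem_of_pow_mem _ hdw
      rw [← hwv]
      change algebraMap (𝓞 K) (𝓞 L) (p : 𝓞 K) ∈ w.asIdeal
      rwa [map_natCast]
    -- `d ∣ ord_w(u)`
    have hdvd : (d : ℤ) ∣ log (w.valuation L u) := hdh.trans (hc w hwS)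
    -- `σ` is an inertia element at `𝔓'`
    have hσ' : σL ∈ 𝔓'.inertia (AlgebraicClosure K ≃ₐ[L] AlgebraicClosure K) := by
      rw [Ideal.inertia, AddSubgroup.mem_inertia]
      intro x
      change ι (σL • x - x) ∈ 𝔓
      rw [map_sub]
      have hx : ι (σL • x) = σ • ι x := Subtype.ext (by
        change ((σL • x : integralClosure (𝓞 L) (AlgebraicClosure K)) : AlgebraicClosure K) =
          σ • (x : AlgebraicClosure K)
        rw [integralClosure.coe_smul]
        rfl)
      rw [hx]
      rw [Ideal.inertia, AddSubgroup.mem_inertia] at hσ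
      exact hσ (ι x)
    have key := smul_root_eq_of_mem_inertia_of_dvd hd0 hζL' hu0 w hdw hdvd hα' 𝔓' hσ'
    rwa [hσLapply] at key
  -- conclusion
  refine ⟨e, h', hndvd, c⁻¹, inv_ne_zero hc0, α, hαN, ?_⟩
  have hu : algebraMap L (AlgebraicClosure K) u = b ^ h * algebraMap K (AlgebraicClosure K) c := by
    rw [hudef, map_mul, map_pow, ← IsScalarTower.algebraMap_apply]
    rfl
  rw [hdecomp, ← hd, hα', hu, map_inv₀, mul_comm, mul_assoc, mul_inv_cancel₀
    ((map_ne_zero _).mpr hc0), mul_one]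

end Literature.NumberTheory.GaloisRepresentations

end
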